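import Mathlib
import Literature.RingTheory.LocalCohomology.CechFiniteness
import Literature.RingTheory.LocalCohomology.CechBaseChange
import Literature.RingTheory.RegularLocalRing.SopRegular
import Summits.Langlands.Langlands.Theorems.SkinnerWilesDefectOneReducibleOrdinaryProModularAlgebraicLefschetz
import Summits.Langlands.Langlands.Theorems.SkinnerWilesDefectOneReducibleOrdinaryProModularCechH2Transport

/-!
# Hypersurfaces in the reflexive hull have connected punctured spectrum

Route `SkinnerWilesDefectOne`, crux `ReducibleOrdinaryProModular` (stmt-Langlands-12919), line
`fine-selmer-codimension-two`, stub (R) `stub_raynaudConnectedness` = Grothendieck's connectedness theorem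
[SGA 2 XIII 2.1]; step (M1a) of the lead's (c3) proof.  Let `S` be a regular local ring of dimension
`d ≥ 3` and `D` a Noetherian local domain, finite over `S` with `S ↪ D`, `𝔪_S D ⊆ 𝔪_D ⊆ √(𝔪_S D)`, which is
a second syzygy over `S` (`0 → D → S^a → S^b` exact — the reflexive hull of `…ReflexiveHull.lean`).  Then
for every `0 ≠ f ∈ 𝔪_D` the punctured spectrum of `D/(f)` is connected
(`Theorems.crossing_one_hypersurface_hull`).  This is the algebraic local Lefschetz theorem
(`…AlgebraicLefschetz.lean`) fed with: a regular system of parameters `y` of `S` (tree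
`isRegular_of_maximalIdeal_pow_le_ofList`), the depth/torsion lemma (H1b, taken here as the hypothesis `hH1b`; landed separately as
`…CechDepthTorsion.lean`) for the `S`-module `D`, and the base change of Čech `H²` from `S` to `D` (`…CechH2Transport.lean`).

* `Theorems.smul_eq_zero_of_mem_map`, `Theorems.exists_pow_smul_eq_zero_of_mem_radical_map` — torsion
  by an ideal `J ⊆ R` extends to `J B` and to powers of elements of `√(J B)`;
* `Theorems.exists_regular_sop` — a regular local ring of dimension `d` has a regular sequence
  `y_1, …, y_d` spanning `𝔪`;
* `Theorems.crossing_one_hypersurface_hull` and the registered sub-goal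
  `stub_raynaudConnectedness_auxHullPunctured`.

References: A. Grothendieck, SGA 2, Exp. XIII §2 [Grothendieck1968SGA2]; H. Matsumura, *Commutative Ring
Theory*, Thm. 17.4 [Matsumura1987].
-/

set_option linter.dupNamespace false -- project-wide option (lakefile weak.linter.dupNamespace); `Summit.Langlands.Langlands` is the mandated namespace
set_option autoImplicit false

noncomputable section

namespace Summit.Langlands.Langlands.Theorems

open IsLocalRing RingTheory.Sequence Literature.RingTheory.LocalCohomology
open Summit.Langlands.Langlands.Cruxes.ReducibleOrdinaryProModular.FineSelmerCodimensionTwo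
  (stub_raynaudConnectedness_auxLefschetz stub_raynaudConnectedness_auxH2BaseChange)

/-! ## 1. Torsion by an ideal extends to the extended ideal and to its radical -/

section Torsion

variable {R B H : Type*} [CommRing R] [CommRing B] [Algebra R B] [AddCommGroup H] [Module B H]

/-- If `J ⊆ R` kills the `B`-module `H` (through `R → B`), so does the extended ideal `J B`. [folklore] -/
theorem smul_eq_zero_of_mem_map (J : Ideal R) (hJ : ∀ h : H, ∀ r ∈ J, algebraMap R B r • h = 0)
    {b : B} (hb : b ∈ J.map (algebraMap R B)) (h : H) : b • h = 0 := by
  induction hb using Submodule.span_induction with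
  | mem x hx =>
    obtain ⟨r, hr, rfl⟩ := hx
    exact hJ h r hr
  | zero => exact zero_smul _ _
  | add x y _ _ hx hy => rw [add_smul, hx, hy, add_zero]
  | smul a x _ hx => rw [smul_eq_mul, mul_smul, hx, smul_zero]

/-- If `J^N ⊆ R` kills `H` and `f ∈ √(J B)`, then a power of `f` kills `H`. [folklore] -/
theorem exists_pow_smul_eq_zero_of_mem_radical_map (J : Ideal R) (N : ℕ)
    (hJ : ∀ h : H, ∀ r ∈ J ^ N, algebraMap R B r • h = 0) {f : B}
    (hf : f ∈ (J.map (algebraMap R B)).radical) : ∃ N' : ℕ, ∀ h : H, f ^ N' • h = 0 := by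
  obtain ⟨k, hk⟩ := hf
  refine ⟨k * N, fun h => ?_⟩
  have hmem : f ^ (k * N) ∈ (J ^ N).map (algebraMap R B) := by
    rw [pow_mul, Ideal.map_pow]
    exact Ideal.pow_mem_pow hk N
  exact smul_eq_zero_of_mem_map (J ^ N) hJ hmem h

end Torsion

/-! ## 2. Regular systems of parameters -/

section Sop

variable {S : Type*} [CommRing S] [IsRegularLocalRing S]

/-- **A regular local ring of dimension `d` has a regular sequence `y_1, …, y_d` spanning `𝔪`** (a
minimal system of generators of `𝔪`; regular by Matsumura Thm. 17.4 (iii), tree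
`isRegular_of_maximalIdeal_pow_le_ofList`). [cite: Matsumura1987, Thm. 17.4 (iii)] -/
theorem exists_regular_sop (d : ℕ) (hd : (d : WithBot ℕ∞) = ringKrullDim S) :
    ∃ y : Fin d → S, Ideal.span (Set.range y) = maximalIdeal S ∧ IsRegular S (List.ofFn y) := by
  classical
  obtain ⟨s, hcard, hspan⟩ :=
    Submodule.FG.exists_span_finset_card_eq_spanFinrank (IsNoetherian.noetherian (maximalIdeal S))
  have hcard' : s.card = d := by
    have h1 : ((maximalIdeal S).spanFinrank : WithBot ℕ∞) = ringKrullDim S :=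
      IsRegularLocalRing.spanFinrank_maximalIdeal
    rw [← hd] at h1
    rw [hcard]
    exact_mod_cast h1
  let e : Fin d ≃ s := (s.equivFinOfCardEq hcard').symm
  refine ⟨fun i => (e i : S), ?_, ?_⟩
  · have hrange : Set.range (fun i => ((e i : s) : S)) = (s : Set S) := by
      ext x
      constructor
      · rintro ⟨i, rfl⟩; exact (e i).2
      · intro hx; exact ⟨e.symm ⟨x, hx⟩, by simp⟩
    rw [hrange]
    exact hspan
  · have hmem : ∀ q ∈ List.ofFn (fun i => ((e i : s) : S)), q ∈ maximalIdeal S := by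
      intro q hq
      rw [List.mem_ofFn] at hq
      obtain ⟨i, rfl⟩ := hq
      rw [← hspan]
      exact Submodule.subset_span (e i).2
    refine Literature.RingTheory.RegularLocalRing.isRegular_of_maximalIdeal_pow_le_ofList hmem
      (by rw [List.length_ofFn, hd]) (N := 1) ?_
    rw [pow_one, ← hspan]
    refine Ideal.span_le.mpr fun x hx => Ideal.subset_span ?_
    show x ∈ {x | x ∈ List.ofFn fun i => ((e i : s) : S)}
    rw [Set.mem_setOf_eq, List.mem_ofFn]
    exact ⟨e.symm ⟨x, hx⟩, by simp⟩

end Sop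

/-! ## 3. The punctured spectrum of a hypersurface in the hull is connected -/

section Hull

variable {S : Type} [CommRing S] [IsRegularLocalRing S]
variable {D : Type} [CommRing D] [IsDomain D] [IsNoetherianRing D] [IsLocalRing D] [Algebra S D]

set_option linter.overlappingInstances false in
/-- **Hypersurfaces in the reflexive hull have connected punctured spectrum.**  Let `S` be a regular
local ring of dimension `d ≥ 3`, `D` a Noetherian local domain, finite over `S` with `S ↪ D`,
`𝔪_S D ⊆ 𝔪_D ⊆ √(𝔪_S D)`, and a second syzygy over `S` (`0 → D → S^a → S^b` exact).  Then for every
`0 ≠ f ∈ 𝔪_D` the punctured spectrum of `D/(f)` is connected (crossing form with bound `1`).  Proof: the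
algebraic local Lefschetz theorem for `B = D`, `y =` a regular system of parameters of `S`: depth `≥ 2`
and the `(y)`-torsion of `H²(y; D)` come from the depth/torsion lemma for second syzygies over `S`
(base-changed to `D`), and `f ∈ 𝔪_D ⊆ √(𝔪_S D)`. [cite: Grothendieck1968SGA2, Exp. XIII §2] -/
theorem crossing_one_hypersurface_hull
    (hH1b : ∀ (R : Type) [CommRing R] [IsNoetherianRing R] (s : ℕ) (y : Fin s → R) (x₁ x₂ x₃ : R), RingTheory.Sequence.IsRegular R [x₁, x₂, x₃] → x₁ ∈ (Ideal.span (Set.range y)).radical → x₂ ∈ (Ideal.span (Set.range y)).radical → x₃ ∈ (Ideal.span (Set.range y)).radical → ∀ (M : Type) [AddCommGroup M] [Module R M] (a b : ℕ) (Φ : M →ₗ[R] (Fin a → R)) (Ψ : (Fin a → R) →ₗ[R] (Fin b → R)), Function.Injective Φ → LinearMap.range Φ = LinearMap.ker Ψ → RingTheory.Sequence.IsWeaklyRegular M [x₁, x₂] ∧ ∃ N : ℕ, ∀ c : Literature.RingTheory.LocalCohomology.H2 (y := y) (M := M), ∀ r ∈ Ideal.span (Set.range y) ^ N, r • c = 0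)
    (_hinj : Function.Injective (algebraMap S D))
    (hmS : (maximalIdeal S).map (algebraMap S D) ≤ maximalIdeal D)
    (hradS : maximalIdeal D ≤ ((maximalIdeal S).map (algebraMap S D)).radical)
    {a b : ℕ} (Φ : D →ₗ[S] (Fin a → S)) (Ψ : (Fin a → S) →ₗ[S] (Fin b → S))
    (hΦ : Function.Injective Φ) (hex : LinearMap.range Φ = LinearMap.ker Ψ)
    {d : ℕ} (hd : (d : WithBot ℕ∞) = ringKrullDim S) (h3 : 3 ≤ d)
    {f : D} (hf0 : f ≠ 0) (hfm : f ∈ maximalIdeal D)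
    (T : Set (PrimeSpectrum (D ⧸ Ideal.span {f})))
    (h₁ : ∃ C ∈ T, C.asIdeal ∈ minimalPrimes (D ⧸ Ideal.span {f}))
    (h₂ : ∃ C ∉ T, C.asIdeal ∈ minimalPrimes (D ⧸ Ideal.span {f})) :
    ∃ C₁ ∈ T, ∃ C₂ ∉ T, C₁.asIdeal ∈ minimalPrimes (D ⧸ Ideal.span {f}) ∧
      C₂.asIdeal ∈ minimalPrimes (D ⧸ Ideal.span {f}) ∧
      (1 : WithBot ℕ∞) ≤ ringKrullDim ((D ⧸ Ideal.span {f}) ⧸ (C₁.asIdeal ⊔ C₂.asIdeal)) := by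
  classical
  -- a regular system of parameters `Q` of `S`, `d = 3 + n`
  obtain ⟨n, rfl⟩ : ∃ n, d = 3 + n := Nat.exists_eq_add_of_le h3
  obtain ⟨Q, hQspan, hQreg⟩ := exists_regular_sop (S := S) (3 + n) hd
  have hQm : ∀ i, Q i ∈ maximalIdeal S := fun i => by
    rw [← hQspan]; exact Ideal.subset_span ⟨i, rfl⟩
  -- its image `y` in `D`
  set y : Fin (3 + n) → D := fun i => algebraMap S D (Q i) with hy_def
  have hyspan : Ideal.span (Set.range y) = (maximalIdeal S).map (algebraMap S D) := by
    rw [← hQspan, Ideal.map_span, ← Set.range_comp]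
    rfl
  have hy : ∀ i, y i ∈ maximalIdeal D := fun i => hmS (Ideal.mem_map_of_mem _ (hQm i))
  have hrad : maximalIdeal D ≤ (Ideal.span (Set.range y)).radical := by rw [hyspan]; exact hradS
  -- the first three parameters form an `S`-regular sequence in `√(Q)`
  have hsplit : List.ofFn Q = [Q (Fin.castAdd n 0), Q (Fin.castAdd n 1), Q (Fin.castAdd n 2)] ++
      List.ofFn (fun j => Q (Fin.natAdd 3 j)) := by
    rw [List.ofFn_add]
    simp [List.ofFn_succ]
    refine ⟨rfl, rfl, rfl⟩
  have hreg3 : IsRegular S [Q (Fin.castAdd n 0), Q (Fin.castAdd n 1), Q (Fin.castAdd n 2)] := by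
    have hw : IsWeaklyRegular S [Q (Fin.castAdd n 0), Q (Fin.castAdd n 1), Q (Fin.castAdd n 2)] := by
      have := hQreg.toIsWeaklyRegular
      rw [hsplit, isWeaklyRegular_append_iff] at this
      exact this.1
    refine (IsLocalRing.isRegular_iff_isWeaklyRegular_of_subset_maximalIdeal ?_).mpr hw
    intro r hr
    simp only [List.mem_cons, List.not_mem_nil, or_false] at hr
    rcases hr with rfl | rfl | rfl <;> exact hQm _
  have hxrad : ∀ i, Q i ∈ (Ideal.span (Set.range Q)).radical := fun i =>
    Ideal.le_radical (Ideal.subset_span ⟨i, rfl⟩)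
  -- (H1b): `D` is a second syzygy over `S`: regular pair and `(Q)`-torsion of `H²(Q; D)`
  obtain ⟨hwreg, N, hN⟩ := hH1b S (3 + n) Q _ _ _ hreg3 (hxrad _) (hxrad _) (hxrad _) D a b Φ Ψ hΦ hex
  -- depth `≥ 2` for the ring `D` with respect to `y`
  have hdepth : ∃ z₁ z₂ : D, IsRegular D [z₁, z₂] ∧ z₁ ∈ (Ideal.span (Set.range y)).radical ∧
      z₂ ∈ (Ideal.span (Set.range y)).radical := by
    refine ⟨y (Fin.castAdd n 0), y (Fin.castAdd n 1), ?_,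
      Ideal.le_radical (Ideal.subset_span ⟨_, rfl⟩), Ideal.le_radical (Ideal.subset_span ⟨_, rfl⟩)⟩
    have hw : IsWeaklyRegular D ([Q (Fin.castAdd n 0), Q (Fin.castAdd n 1)].map (algebraMap S D)) :=
      (isWeaklyRegular_map_algebraMap_iff D D _).mpr hwreg
    refine (IsLocalRing.isRegular_iff_isWeaklyRegular_of_subset_maximalIdeal ?_).mpr hw
    intro r hr
    simp only [List.mem_cons, List.not_mem_nil, or_false] at hr
    rcases hr with rfl | rfl <;> exact hy _
  -- `f`-power torsion of `H²(y; D)` (base change `S → D`, then `f ∈ √(𝔪_S D)`)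
  have hH2 : ∃ N' : ℕ, ∀ c : H2 (y := y) (M := D), f ^ N' • c = 0 := by
    have hB := stub_raynaudConnectedness_auxH2BaseChange S D (3 + n) Q D
      (Ideal.span (Set.range Q) ^ N) hN
    have hf' : f ∈ ((Ideal.span (Set.range Q)).map (algebraMap S D)).radical := by
      rw [hQspan]; exact hradS hfm
    exact exists_pow_smul_eq_zero_of_mem_radical_map (R := S) (B := D) (H := H2 (y := y) (M := D))
      (Ideal.span (Set.range Q)) N hB hf'
  -- the algebraic local Lefschetz theorem
  have hfreg : IsSMulRegular D f := (IsRegular.of_ne_zero hf0).left.isSMulRegular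
  exact stub_raynaudConnectedness_auxLefschetz D (3 + n) y f hy hrad hfm hfreg hdepth hH2 T h₁ h₂

end Hull

end Summit.Langlands.Langlands.Theorems

/-! ## 4. The registered sub-goal (verbatim signature) -/

namespace Summit.Langlands.Langlands.Cruxes.ReducibleOrdinaryProModular.FineSelmerCodimensionTwo

set_option linter.overlappingInstances false in
/-- **Registered sub-goal `stub_raynaudConnectedness_auxHullPunctured` of stub (R) `stub_raynaudConnectedness`**
(c3, SGA 2 XIII 2.1 programme, step (M1a)): hypersurfaces in the reflexive hull have connected punctured
spectrum, given the depth/torsion lemma (H1b) — `Theorems.crossing_one_hypersurface_hull`.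
[cite: Grothendieck1968SGA2, Exp. XIII §2] -/
theorem stub_raynaudConnectedness_auxHullPunctured :
    (∀ (R : Type) [CommRing R] [IsNoetherianRing R] (s : ℕ) (y : Fin s → R) (x₁ x₂ x₃ : R), RingTheory.Sequence.IsRegular R [x₁, x₂, x₃] → x₁ ∈ (Ideal.span (Set.range y)).radical → x₂ ∈ (Ideal.span (Set.range y)).radical → x₃ ∈ (Ideal.span (Set.range y)).radical → ∀ (M : Type) [AddCommGroup M] [Module R M] (a b : ℕ) (Φ : M →ₗ[R] (Fin a → R)) (Ψ : (Fin a → R) →ₗ[R] (Fin b → R)), Function.Injective Φ → LinearMap.range Φ = LinearMap.ker Ψ → RingTheory.Sequence.IsWeaklyRegular M [x₁, x₂] ∧ ∃ N : ℕ, ∀ c : Literature.RingTheory.LocalCohomology.H2 (y := y) (M := M), ∀ r ∈ Ideal.span (Set.range y) ^ N, r • c = 0) → ∀ (S : Type) [CommRing S] [IsRegularLocalRing S] (D : Type) [CommRing D] [IsDomain D] [IsNoetherianRing D] [IsLocalRing D] [Algebra S D] [Module.Finite S D], Function.Injective (algebraMap S D) → (IsLocalRing.maximalIdeal S).map (algebraMap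 S D) ≤ IsLocalRing.maximalIdeal D → IsLocalRing.maximalIdeal D ≤ ((IsLocalRing.maximalIdeal S).map (algebraMap S D)).radical → ∀ (a b : ℕ) (Φ : D →ₗ[S] (Fin a → S)) (Ψ : (Fin a → S) →ₗ[S] (Fin b → S)), Function.Injective Φ → LinearMap.range Φ = LinearMap.ker Ψ → ∀ (d : ℕ), (d : WithBot ℕ∞) = ringKrullDim S → 3 ≤ d → ∀ f : D, f ≠ 0 → f ∈ IsLocalRing.maximalIdeal D → ∀ T : Set (PrimeSpectrum (D ⧸ Ideal.span {f})), (∃ C ∈ T, C.asIdeal ∈ minimalPrimes (D ⧸ Ideal.span {f})) → (∃ C ∉ T, C.asIdeal ∈ minimalPrimes (D ⧸ Ideal.span {f})) → ∃ C₁ ∈ T, ∃ C₂ ∉ T, C₁.asIdeal ∈ minimalPrimes (D ⧸ Ideal.span {f}) ∧ C₂.asIdeal ∈ minimalPrimes (D ⧸ Ideal.span {f}) ∧ (1 : WithBot ℕ∞) ≤ ringKrullDim ((D ⧸ Ideal.span {f}) ⧸ (C₁.asIdeal ⊔ C₂.asIdeal)) :=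
  fun hH1b _S _ _ _D _ _ _ _ _ _ hinj hmS hradS _a _b Φ Ψ hΦ hex _d hd h3 _f hf0 hfm T h₁ h₂ =>
    Summit.Langlands.Langlands.Theorems.crossing_one_hypersurface_hull hH1b hinj hmS hradS Φ Ψ hΦ hex hd h3
      hf0 hfm T h₁ h₂

end Summit.Langlands.Langlands.Cruxes.ReducibleOrdinaryProModular.FineSelmerCodimensionTwo

end
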